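import Summits.HodgeConjecture.CorCM.GaloisQuaternionCyclicPrimeNormPairs
import HarnessLib

/-!
# `μ₄`-norm-pair certificates: `Q₈ × C_p` is BAD for `p = 13, 17, 19`

COR-CM (cell `pub-hodgecm2`), binder seat b04 (gen 28), count-neutral claim QUATERNION-CYCLIC-PRIME-DEGENERATE, part III —
instances of part II (`GaloisQuaternionCyclic.exists_simple_degenerate_of_normPair`): a Galois CM field `K` with `Gal(K/ℚ) ≅
Q₈ × C_p` carries a simple DEGENERATE CM abelian `4p`-fold with a rational `(q,q)` class outside the divisor ring on some
power as soon as `ℤ/p` has a `μ₄`-norm pair `(k₀, k₁)`; the whole certificate is two vectors in `(ℤ/4)^p`, checked by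
`decide` on `ℤ/p` alone (no balanced set on the group of order `8p`).  The pairs were found by the seat's PB-SAT search
(`jobs/q8sat`, compute jobs j213543 / j213598: seconds to minutes per prime); they exist exactly for the primes tried with
`ord_p 2` EVEN (13, 17, 19), in line with gen 25's dichotomy «`Q₈ × C_p` is GOOD iff `ord_p 2` is odd» (GOOD side proved in
`CorCM/GaloisQuaternionCyclicPrimeNondegenerate`; BAD side previously certified only for `p = 3, 5, 11`).  KERNEL ONLY:
theorems; no definition, no named fact, no `sorry`.  `HC_CM` is neither used nor claimed.

## References

* [Shimura1998] G. Shimura, *Abelian Varieties with Complex Multiplication and Modular Functions*, §6.2 Thm. 3, §8.2 Prop. 26.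
* [Gordon1999HodgeAVSurvey] B. B. Gordon, *A survey of the Hodge conjecture for abelian varieties*, Thm. 6.4, §9.3.
-/

noncomputable section

open CategoryTheory CategoryTheory.Limits NumberField
open scoped BigOperators

namespace Summit.HodgeConjecture.CorCM.GaloisQuaternionCyclic

open Literature.NumberTheory.ComplexMultiplication
open Literature.AlgebraicGeometry.Motives (AbelianVariety CMType)
open Literature.AlgebraicGeometry.HodgeTheory
open Literature.AlgebraicGeometry.ComplexMultiplication (IsCMTypeRealisation)
open Literature.AlgebraicGeometry.Pohlmann1968
open Literature.Barriers.HodgeConjecture (divisorClassesSpan)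

variable {K : Type} [Field K] [NumberField K] [IsCMField K] [IsGalois ℚ K]

/-- **`Gal(K/ℚ) ≅ Q₈ × C_13` is BAD** (`ord_13 2` is even): the `μ₄`-norm pair `k₀ = [0, 3, 0, 3, 1, 3, 3, 2, 0, 2, 0, 0, 2]`,
`k₁ = [2, 1, 0, 1, 1, 3, 1, 0, 0, 2, 0, 2, 0]` in `ℤ/13` gives a simple DEGENERATE abelian `52`-fold with CM by `K` and a
rational `(q,q)` class outside the divisor ring on some power. [cite: Shimura1998, §6.2 Thm. 3 and §8.2 Prop. 26] [cite:
Gordon1999HodgeAVSurvey, Thm. 6.4 and §9.3] -/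
theorem exists_simple_degenerate_quaternion_cyclic13 (e : (K ≃ₐ[ℚ] K) ≃* QuaternionGroup 2 × Multiplicative (ZMod 13)) :
    ∃ (Φ : CMType K) (φ₀ : K →+* ℂ) (A : AbelianVariety ℂ) (ι : 𝓞 K →+* End A)
      (θ : K →+* Module.End ℂ (complexBetti A.X 1)),
      IsPrimitive (ℂ ≃+* ℂ) Φ.1 φ₀ ∧ ¬ IsNondegenerate Φ ∧ IsCMTypeRealisation Φ A ι θ ∧ A.IsSimple ∧ A.dim = 52 ∧
      ∃ n q : ℕ, ∃ x : complexBetti (⨁ fun _ : Fin n => A).X (2 * q), IsRationalClass x ∧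
        IsOfHodgeType (⨁ fun _ : Fin n => A).dim (⨁ fun _ : Fin n => A).X (2 * q) q q x ∧
        x ∉ divisorClassesSpan (⨁ fun _ : Fin n => A).X (⨁ fun _ : Fin n => A).dim q := by
  obtain ⟨Φ, φ₀, A, ι, θ, h1, h2, h3, h4, h5, h6⟩ := @exists_simple_degenerate_of_normPair 13 ⟨by norm_num⟩ K _ _ _ _
    (by norm_num) e
    ![0, 3, 0, 3, 1, 3, 3, 2, 0, 2, 0, 0, 2]
    ![2, 1, 0, 1, 1, 3, 1, 0, 0, 2, 0, 2, 0]
    ⟨1, by decide⟩ (by decide) (by decide)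
  exact ⟨Φ, φ₀, A, ι, θ, h1, h2, h3, h4, by norm_num at h5; exact h5, h6⟩

/-- **`Gal(K/ℚ) ≅ Q₈ × C_17` is BAD** (`ord_17 2` is even): the `μ₄`-norm pair `k₀ = [0, 3, 0, 3, 3, 2, 2, 0, 2, 1, 1, 3, 1, 0,
0, 1, 0]`, `k₁ = [1, 0, 3, 2, 0, 3, 3, 3, 1, 0, 2, 2, 2, 3, 3, 0, 3]` in `ℤ/17` gives a simple DEGENERATE abelian `68`-fold
with CM by `K` and a rational `(q,q)` class outside the divisor ring on some power. [cite: Shimura1998, §6.2 Thm. 3 and §8.2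
Prop. 26] [cite: Gordon1999HodgeAVSurvey, Thm. 6.4 and §9.3] -/
theorem exists_simple_degenerate_quaternion_cyclic17 (e : (K ≃ₐ[ℚ] K) ≃* QuaternionGroup 2 × Multiplicative (ZMod 17)) :
    ∃ (Φ : CMType K) (φ₀ : K →+* ℂ) (A : AbelianVariety ℂ) (ι : 𝓞 K →+* End A)
      (θ : K →+* Module.End ℂ (complexBetti A.X 1)),
      IsPrimitive (ℂ ≃+* ℂ) Φ.1 φ₀ ∧ ¬ IsNondegenerate Φ ∧ IsCMTypeRealisation Φ A ι θ ∧ A.IsSimple ∧ A.dim = 68 ∧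
      ∃ n q : ℕ, ∃ x : complexBetti (⨁ fun _ : Fin n => A).X (2 * q), IsRationalClass x ∧
        IsOfHodgeType (⨁ fun _ : Fin n => A).dim (⨁ fun _ : Fin n => A).X (2 * q) q q x ∧
        x ∉ divisorClassesSpan (⨁ fun _ : Fin n => A).X (⨁ fun _ : Fin n => A).dim q := by
  obtain ⟨Φ, φ₀, A, ι, θ, h1, h2, h3, h4, h5, h6⟩ := @exists_simple_degenerate_of_normPair 17 ⟨by norm_num⟩ K _ _ _ _
    (by norm_num) e
    ![0, 3, 0, 3, 3, 2, 2, 0, 2, 1, 1, 3, 1, 0, 0, 1, 0]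
    ![1, 0, 3, 2, 0, 3, 3, 3, 1, 0, 2, 2, 2, 3, 3, 0, 3]
    ⟨1, by decide⟩ (by decide) (by decide)
  exact ⟨Φ, φ₀, A, ι, θ, h1, h2, h3, h4, by norm_num at h5; exact h5, h6⟩

/-- **`Gal(K/ℚ) ≅ Q₈ × C_19` is BAD** (`ord_19 2` is even): the `μ₄`-norm pair `k₀ = [0, 2, 3, 2, 3, 0, 3, 3, 1, 2, 3, 0, 1, 2,
1, 2, 3, 2, 3]`, `k₁ = [1, 1, 0, 3, 2, 1, 0, 0, 0, 3, 2, 1, 0, 1, 0, 3, 2, 1, 2]` in `ℤ/19` gives a simple DEGENERATE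
abelian `76`-fold with CM by `K` and a rational `(q,q)` class outside the divisor ring on some power. [cite: Shimura1998,
§6.2 Thm. 3 and §8.2 Prop. 26] [cite: Gordon1999HodgeAVSurvey, Thm. 6.4 and §9.3] -/
theorem exists_simple_degenerate_quaternion_cyclic19 (e : (K ≃ₐ[ℚ] K) ≃* QuaternionGroup 2 × Multiplicative (ZMod 19)) :
    ∃ (Φ : CMType K) (φ₀ : K →+* ℂ) (A : AbelianVariety ℂ) (ι : 𝓞 K →+* End A)
      (θ : K →+* Module.End ℂ (complexBetti A.X 1)),
      IsPrimitive (ℂ ≃+* ℂ) Φ.1 φ₀ ∧ ¬ IsNondegenerate Φ ∧ IsCMTypeRealisation Φ A ι θ ∧ A.IsSimple ∧ A.dim = 76 ∧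
      ∃ n q : ℕ, ∃ x : complexBetti (⨁ fun _ : Fin n => A).X (2 * q), IsRationalClass x ∧
        IsOfHodgeType (⨁ fun _ : Fin n => A).dim (⨁ fun _ : Fin n => A).X (2 * q) q q x ∧
        x ∉ divisorClassesSpan (⨁ fun _ : Fin n => A).X (⨁ fun _ : Fin n => A).dim q := by
  obtain ⟨Φ, φ₀, A, ι, θ, h1, h2, h3, h4, h5, h6⟩ := @exists_simple_degenerate_of_normPair 19 ⟨by norm_num⟩ K _ _ _ _
    (by norm_num) e
    ![0, 2, 3, 2, 3, 0, 3, 3, 1, 2, 3, 0, 1, 2, 1, 2, 3, 2, 3]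
    ![1, 1, 0, 3, 2, 1, 0, 0, 0, 3, 2, 1, 0, 1, 0, 3, 2, 1, 2]
    ⟨1, by decide⟩ (by decide) (by decide)
  exact ⟨Φ, φ₀, A, ι, θ, h1, h2, h3, h4, by norm_num at h5; exact h5, h6⟩

end Summit.HodgeConjecture.CorCM.GaloisQuaternionCyclic

end
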